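import Summits.QuantumFields.YangMills.Theorems.BalabanUVNodesN15TwoSpacingGluingCurvedKnitDefectObjects
import HarnessLib

/-!
# THE GLUING STEP AT TWO LATTICE SPACINGS — (Γ15b) THE LIVE-`U` KNIT AT THE COVER, TWO GRIDS, VII: dag-n15-w3's TWO `U(m)` CAPSTONES (52) INSTANTIATED ON THE FINE GRID — the glued operator
# `cvGlued'` of the dressed smooth-cut Neumann cubes at spacing `(L^rL^k)^{−1}` DECAYS and IS THE TWO-SIDED INVERSE of Bałaban's `Δ′_{R_U′} + P′`, with the SAME constants as FILE 120
# (uniform in the refinement `r`); every row of 52 DISCHARGED BY NAME, the small-field letters DISPLAYED (dag-n15-c g15, FILE 124; N15 = NE2, s1 «background-layer OPERATOR ingredient»)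

Cell `pub-ymgap`, seat `pub-ymgap-dag-n15-c` (R134 (a); HUMAN RULING D-0062), generation 15.  `bears_on: R4∕N15 · K3⁸ SpineGivenEndpointR13SepCoPHV (stmt-QuantumFields-27366)`.
Filed `--kind proof --supports stmt-QuantumFields-27366 --as helper` — COUNT-NEUTRAL.  One theorem; 0 `def`, 0 `sorry`; `maxHeartbeats 400000` ∕ `maxRecDepth 2048` for the size of 52's
terms only.  Imports BY NAME FILE 123a `…CurvedKnitDefectObjects` (the fine objects `CvX'`, `cvChi'`, `cvPsi'`, `cvBump'`, `cvCube'`, `cvNL'`, `cvGlued'`; through it FILE 119 (`cvM`, `cvSk`,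
`cvSmall`, the window arithmetic) and FILES 117∕118, 66–72, dag-n15-w4 V–VII, dag-n15-a N-II∕N-III, dag-n15-w3 52).  This file is FILE 120 `uN_cvGlued_spec` RE-RUN VERBATIM at the fine
spacing `n′ = L^rL^k` of the same doubled torus `2L·L^m` (every cover row of FILES 117∕118 is generic in the spacing; the torus letters come from dag-n15-a's `ineq110_114_pair` second
conjunct); together with FILE 120 (coarse grid) and FILE 123 (the η-defect through King's pairing) it completes the two-grid picture of the live-`U` knit: BOTH glued operators exist,
are two-sided inverses, decay at rate `δ∕16`, and differ by `O((L^k)^{−1∕16} + fits)`.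

HONEST FRAMING ∕ LIMITS.  As FILE 120: the model cover (finite doubled torus, flat cubes by images, abstract `P′`, `N′_V`), the displayed hypotheses are the paper's small-field hypotheses
((3.35) on the cut boxes) and the lane's letters, whose producers are NOT here; the SHAPE of [B9] Thm 3.1 («G(U) exists and decays for M ≥ M₁»), NOT the printed theorem; nothing of
[B5]∕[B6]∕[B9] asserted.  NE2⁺ NOT PRINTED, NOT proved; N15 NOT discharged; K3⁸ OPEN, skeleton v6 untouched; counts of record UNMOVED (typed 28∕28 · discharged 5∕27); one finite 𝕋⁴
at fixed ε — NOT infinite volume, NOT OS on ℝ⁴, NOT a mass gap, NOT Clay; R4 closes the conditional finite-𝕋⁴ rung `BalabanLadder.UV` only.  Restate-immune.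
-/

noncomputable section

open scoped BigOperators Matrix Matrix.Norms.Frobenius

namespace Summit.QuantumFields.YangMills.BalabanUVNodes.N15.Gluing

open Real
open Literature.MathematicalPhysics.QuantumFieldTheory.Balaban1983to89
open Literature.MathematicalPhysics.QuantumFieldTheory.Balaban1983to89.B5Prop11Plancherel (Tor fine unitVec)
open Literature.MathematicalPhysics.QuantumFieldTheory.Balaban1983to89.B11SectG (BlockNorm HasMaj RowSum)
open Literature.MathematicalPhysics.QuantumFieldTheory.Balaban1983to89.B6RandomWalk (Triangle254)
open Literature.MathematicalPhysics.QuantumFieldTheory.Balaban1983to89.B6Prop26Gluing (mulOp mulOp_apply ind ind_nonneg ind_le_one)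
open Literature.MathematicalPhysics.QuantumFieldTheory.Balaban1983to89.B6UnitTorusCarrier (unitTorusGeo triangle254_unitTorusGeo rowSum_unitTorusGeo unitTorusGeo_dist_nonneg
  unitTorusGeo_dist_symm unitTorusGeo_dist_self)
open Literature.MathematicalPhysics.QuantumFieldTheory.Balaban1983to89.B5SiteBridgeP12 (MP)
open Literature.MathematicalPhysics.QuantumFieldTheory.King1986.Torus (blockOf tdistT tdistT_nonneg tdistT_symm)
open Literature.Barriers.QuantumFields (traceForm)
open Summit.QuantumFields.YangMills.BalabanUVNodes.N15.BackgroundLayer (fgrad fgradAdj bgrad fgrad_apply fgradAdj_apply bgrad_apply stack projO bgPropV covLapM tCoefA tCoefC unstackM)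
open Summit.QuantumFields.YangMills.BalabanUVNodes.N15.VectorPiece (bshiftEquiv bshiftEquiv_apply tensorId hasMaj_tensorId tdistT_blockOf_sub_unitVec_le)
open Summit.QuantumFields.YangMills.BalabanUVNodes.N15.MatrixSpecies (mmulOp coordMat liftBlk liftEquiv liftEquiv_apply liftEquiv_symm_apply)
open Summit.QuantumFields.YangMills.BalabanUVNodes.N15.TwoGrid (paramsOf symbOp sD landauRe qvRe qvAdjRe gOp neumannCubeG chiCube cubeBlocks ineq110_114_pair hasMaj_gOp_of_ineq hasMaj_grad_of_ineq
  hasMaj_landauRe chiCube_of_not_mem abs_chiCube_le_one)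
open Summit.QuantumFields.YangMills.BalabanUVNodes.N15.CurvedSpecies (gaugePair uN_hasMaj_glueInv_smoothCutDressed_localGauges uN_glueInv_smoothCutDressed_localGauges_inverse)

variable {d : ℕ}

/-! ## §1 The live-`U` knit at the cover on the FINE grid (spacing `(L^rL^k)^{-1}`), uniformly in the refinement `r` -/

section Knit

variable {L : ℕ} [NeZero L]

set_option maxHeartbeats 400000 in
set_option maxRecDepth 2048 in
/-- ★★★ **THE LIVE-`U` KNIT AT THE COVER ON THE FINE GRID (dag-n15-w3 52 INSTANTIATED AT SPACING `(L^rL^k)^{−1}`): THE GLUED PROPAGATOR `cvGlued'` OF BAŁABAN's `Δ′_{R_U′} + P′` DECAYS AND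
IS ITS TWO-SIDED INVERSE**, with the SAME `δ, w₀, R₀, θ₀, B` as FILE 120 for every refinement `r` — every cover ∕ cube ∕ bump ∕ partition ∕ tail ∕ commutator row of 52 DISCHARGED BY NAME at the
fine spacing, the small-field letters and the lane's `P′`∕`N′_V` letters DISPLAYED.  MODEL carriers; NOT [B9] Thm 3.1 as printed.
[cite: Balaban1985BackgroundPropagators, Thm 3.1 p.397 (shape), (3.34)–(3.35) p.396, (3.62)–(3.65) pp.402–403, (3.76)–(3.77) p.406 (mechanism); Balaban1984PropagatorsII, (2.36)–(2.37) p.229, (2.91)–(2.93) p.239, (2.133)–(2.136) p.247] -/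
theorem uN_cvGlued'_spec (hL : Odd L ∧ 1 < L) (hL7 : 7 ≤ L) {a : ℝ} (ha : 0 < a) (ι : Type) [Fintype ι] [DecidableEq ι] :
    ∃ δ w₀ R₀ θ₀ B : ℝ, 0 < δ ∧ 0 < R₀ ∧ 0 < θ₀ ∧ 0 < B ∧
      ∀ (mv kk r : ℕ), 1 ≤ kk → w₀ ≤ ((L ^ mv : ℕ) : ℝ) →
      ∀ {mm : Type} [Fintype mm] [DecidableEq mm] (e : Matrix mm mm ℂ ≃L[ℝ] (ι → ℝ)), (∀ A B : Matrix mm mm ℂ, traceForm A B = e A ⬝ᵥ e B) →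
      ∀ (u : (Fin (d + 1) → ZMod (2 * L)) → CvX' d L mv kk r hL → Matrix mm mm ℂ), (∀ k x, (u k x)ᴴ * u k x = 1) →
      ∀ (U : Fin (d + 1) → CvX' d L mv kk r hL → Matrix mm mm ℂ) (P : (CvX' d L mv kk r hL × ι → ℝ) →ₗ[ℝ] (CvX' d L mv kk r hL × ι → ℝ))
        (NV : (Fin (d + 1) → ZMod (2 * L)) → (CvX' d L mv kk r hL × ι → ℝ) →ₗ[ℝ] (CvX' d L mv kk r hL × ι → ℝ)) (rV RN θF : ℝ),
        0 ≤ rV → 0 ≤ RN → 0 ≤ θF → rV * (1 + Fintype.card (Fin (d + 1) ⊕ Fin (d + 1))) + RN ≤ R₀ → θF ≤ θ₀ →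
        (∀ k, mmulOp (fun x => coordMat e (ContinuousLinearMap.mulLeftRight ℝ (Matrix mm mm ℂ) (u k x) (u k x)ᴴ)) ∘ₗ P ∘ₗ mmulOp (fun x => (coordMat e (ContinuousLinearMap.mulLeftRight ℝ (Matrix mm mm ℂ) (u k x) (u k x)ᴴ))ᵀ) = (cvNL' d L mv kk r hL a ι) - NV k) →
        (∀ k x, cvChi' d L mv kk r hL k x ≠ 0 → ∀ i, ∑ j, |tCoefC ((((L ^ r * L ^ kk : ℕ) : ℝ))⁻¹) (gaugePair (bshiftEquiv (cvM d L mv kk hL) (L ^ r * L ^ kk)) fun μ x => coordMat e (ContinuousLinearMap.mulLeftRight ℝ (Matrix mm mm ℂ) (u k x * U μ x * (u k (bshiftEquiv (cvM d L mv kk hL) (L ^ r * L ^ kk) μ x))ᴴ) (u k x * U μ x * (u k (bshiftEquiv (cvM d L mv kk hL) (L ^ r * L ^ kk) μ x))ᴴ)ᴴ)) x i j| ≤ rV) →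
        (∀ k j' x, cvChi' d L mv kk r hL k x ≠ 0 → ∀ i, ∑ j, |tCoefA ((((L ^ r * L ^ kk : ℕ) : ℝ))⁻¹) (gaugePair (bshiftEquiv (cvM d L mv kk hL) (L ^ r * L ^ kk)) fun μ x => coordMat e (ContinuousLinearMap.mulLeftRight ℝ (Matrix mm mm ℂ) (u k x * U μ x * (u k (bshiftEquiv (cvM d L mv kk hL) (L ^ r * L ^ kk) μ x))ᴴ) (u k x * U μ x * (u k (bshiftEquiv (cvM d L mv kk hL) (L ^ r * L ^ kk) μ x))ᴴ)ᴴ)) j' x i j| ≤ rV) →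
        (∀ k, HasMaj (BlockNorm.ofBlocks (unitTorusGeo L kk (cvM d L mv kk hL)) (liftBlk (fun b : CvX' d L mv kk r hL => blockOf (L ^ r * L ^ kk) (cvM d L mv kk hL) b.1) ι)) (BlockNorm.ofBlocks (unitTorusGeo L kk (cvM d L mv kk hL)) (liftBlk (fun b : CvX' d L mv kk r hL => blockOf (L ^ r * L ^ kk) (cvM d L mv kk hL) b.1) ι)) (mulOp (fun p : CvX' d L mv kk r hL × ι => cvPsi' d L mv kk r hL k p.1) ∘ₗ NV k ∘ₗ mulOp (fun p : CvX' d L mv kk r hL × ι => cvChi' d L mv kk r hL k p.1)) (fun y y' => RN * Real.exp (-(δ * (unitTorusGeo L kk (cvM d L mv kk hL)).dist y y')))) →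
        (∀ k, HasMaj (BlockNorm.ofBlocks (unitTorusGeo L kk (cvM d L mv kk hL)) (liftBlk (fun b : CvX' d L mv kk r hL => blockOf (L ^ r * L ^ kk) (cvM d L mv kk hL) b.1) ι)) (BlockNorm.ofBlocks (unitTorusGeo L kk (cvM d L mv kk hL)) (liftBlk (fun b : CvX' d L mv kk r hL => blockOf (L ^ r * L ^ kk) (cvM d L mv kk hL) b.1) ι)) ((LinearMap.id - mulOp (fun p : CvX' d L mv kk r hL × ι => cvPsi' d L mv kk r hL k p.1)) ∘ₗ NV k ∘ₗ mulOp (fun p : CvX' d L mv kk r hL × ι => cvChi' d L mv kk r hL k p.1)) (fun y y' => θF * Real.exp (-(δ * (unitTorusGeo L kk (cvM d L mv kk hL)).dist y y')))) →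
        HasMaj (BlockNorm.ofBlocks (unitTorusGeo L kk (cvM d L mv kk hL)) (liftBlk (fun b : CvX' d L mv kk r hL => blockOf (L ^ r * L ^ kk) (cvM d L mv kk hL) b.1) ι)) (BlockNorm.ofBlocks (unitTorusGeo L kk (cvM d L mv kk hL)) (liftBlk (fun b : CvX' d L mv kk r hL => blockOf (L ^ r * L ^ kk) (cvM d L mv kk hL) b.1) ι)) (cvGlued' d L mv kk r hL a ((((L ^ r * L ^ kk : ℕ) : ℝ))⁻¹) ι e u U P NV)
          (fun y y' => B * Real.exp (-(δ / 16 * (unitTorusGeo L kk (cvM d L mv kk hL)).dist y y'))) ∧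
        (cvGlued' d L mv kk r hL a ((((L ^ r * L ^ kk : ℕ) : ℝ))⁻¹) ι e u U P NV ∘ₗ (covLapM (bshiftEquiv (cvM d L mv kk hL) (L ^ r * L ^ kk)) ((((L ^ r * L ^ kk : ℕ) : ℝ))⁻¹) (gaugePair (bshiftEquiv (cvM d L mv kk hL) (L ^ r * L ^ kk)) (fun μ x => coordMat e (ContinuousLinearMap.mulLeftRight ℝ (Matrix mm mm ℂ) (U μ x) (U μ x)ᴴ))) + P) = LinearMap.id ∧
          (covLapM (bshiftEquiv (cvM d L mv kk hL) (L ^ r * L ^ kk)) ((((L ^ r * L ^ kk : ℕ) : ℝ))⁻¹) (gaugePair (bshiftEquiv (cvM d L mv kk hL) (L ^ r * L ^ kk)) (fun μ x => coordMat e (ContinuousLinearMap.mulLeftRight ℝ (Matrix mm mm ℂ) (U μ x) (U μ x)ᴴ))) + P) ∘ₗ cvGlued' d L mv kk r hL a ((((L ^ r * L ^ kk : ℕ) : ℝ))⁻¹) ι e u U P NV = LinearMap.id) := by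
  obtain ⟨δ₀, C, Cα, Cε, Cαε, hδ₀, hC, H⟩ := ineq110_114_pair (d := d) hL ha
  obtain ⟨δ₁, C₁, hδ₁, hC₁, HL⟩ := hasMaj_landauRe (d := d) (L := L)
  obtain ⟨δm, hδm⟩ : ∃ δm : ℝ, δm = min δ₀ δ₁ := ⟨_, rfl⟩
  have hδm0 : 0 < δm := by rw [hδm]; exact lt_min hδ₀ hδ₁
  have hδmδ₀ : δm ≤ δ₀ := by rw [hδm]; exact min_le_left _ _
  have hδmδ₁ : δm ≤ δ₁ := by rw [hδm]; exact min_le_right _ _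
  set cr : ℝ := B4Sect5Proof.latticeConst (d + 1) (δm / 16) with hcr_def
  have hcr0 : 0 ≤ cr := B4Sect5Proof.latticeConst_nonneg (d + 1) (by positivity)
  set β : ℝ := 2 ^ (d + 1) * (C * Real.exp δ₀) with hβdef
  set β₁ : ℝ := 2 ^ (d + 1) * (C * Real.exp δ₀ * Real.exp δ₀) with hβ₁def
  set cN₀ : ℝ := |a| * (Real.exp δm * Real.exp δm) + C₁ with hcN₀def
  set Nov : ℝ := (((2 * L) ^ (d + 1) : ℕ) : ℝ) with hNovdef
  set cι2 : ℝ := (Fintype.card ι : ℝ) ^ 2 with hcι2def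
  set R : ℝ := 1 / (2 * ((β + (β₁ + π * β)) * cr * cr) + 1) with hRdef
  set θ₀ : ℝ := 1 / (4 * (Nov * cr * (cι2 * (2 * (β + (β₁ + π * β))) * cr)) + 4) with hθ₀def
  set κT : ℝ := 2 ^ (d + 1) * (cN₀ * (4 / δm) * (C * Real.exp δ₀) * cr) with hκTdef
  set A₁ : ℝ := (Fintype.card (Fin (d + 1)) : ℝ) * (32 * π ^ 2 * (2 * (β + (β₁ + π * β))) + 2 * (π * (2 * (β + (β₁ + π * β))))) +
    (π * ((d : ℝ) + 1) * (Real.exp 1 * (δm / 2))⁻¹ + 2 * (π * ((d : ℝ) + 1))) * cN₀ * (2 * (β + (β₁ + π * β))) * cr with hA₁def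
  set A₂ : ℝ := (π * ((d : ℝ) + 1) * (Real.exp 1 * (δm / 2))⁻¹ + 2 * (π * ((d : ℝ) + 1) + π * ((d : ℝ) + 1) * 1)) * R * (2 * (β + (β₁ + π * β))) * cr +
    R * π * (2 * (β + (β₁ + π * β))) * cr with hA₂def
  set w₀ : ℝ := 4 * (Nov * cr * (cι2 * (A₁ + A₂ + 2 * κT))) + 2 with hw₀def
  set Bout : ℝ := Nov * (cι2 * (2 * (β + (β₁ + π * β)))) * 2 * cr + 1 with hBoutdef
  have hβ0 : 0 ≤ β := by positivity
  have hβ₁0 : 0 ≤ β₁ := by positivity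
  have hcN₀0 : 0 ≤ cN₀ := by positivity
  have hNov0 : 0 ≤ Nov := by positivity
  have hκT0 : 0 ≤ κT := by positivity
  have hR0 : 0 < R := by positivity
  have hθ₀0 : 0 < θ₀ := by positivity
  have hA₁0 : 0 ≤ A₁ := by positivity
  have hA₂0 : 0 ≤ A₂ := by positivity
  refine ⟨δm, w₀, R, θ₀, Bout, hδm0, hR0, hθ₀0, by positivity, fun mv kk r hk hw₀ => ?_⟩
  intro mm _ _ e he u hu U P NV rV RN θF hrV hRN hθF0 hRle hθle hP hCloc hAloc hNVcut hfarN
  -- the data of the cover at `(m, k)`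
  have hL3 : 3 ≤ L := by omega
  have hL2 : 2 ≤ L := by omega
  have hn : 1 ≤ L ^ r * L ^ kk := Nat.one_le_iff_ne_zero.mpr (Nat.mul_ne_zero (pow_ne_zero r (NeZero.ne L)) (pow_ne_zero kk (NeZero.ne L)))
  have hW0 : 4 * (Nov * cr * (cι2 * (A₁ + A₂ + 2 * κT))) ≤ ((L ^ mv : ℕ) : ℝ) := by linarith only [hw₀]
  have hW2R : (2 : ℝ) ≤ ((L ^ mv : ℕ) : ℝ) := by
    have : 0 ≤ 4 * (Nov * cr * (cι2 * (A₁ + A₂ + 2 * κT))) := by positivity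
    linarith only [this, hw₀]
  have hW2 : 2 ≤ L ^ mv := by exact_mod_cast hW2R
  have hw : 0 < L ^ mv := by omega
  have hW1 : (1 : ℝ) ≤ ((L ^ mv : ℕ) : ℝ) := by linarith only [hW2R]
  have hWpos : (0 : ℝ) < ((L ^ mv : ℕ) : ℝ) := by linarith only [hW2R]
  have hM : ∀ ν, cvM d L mv kk hL ν = 2 * L * L ^ mv := MP_succ_eq L mv kk hL
  have hM' : ∀ ν, cvM d L mv kk hL ν = 2 * (L * L ^ mv) := fun ν => by rw [hM ν, mul_assoc]
  have hlo : (2 : ℝ) * ((L ^ mv : ℕ) : ℝ) ≤ ((2 * L ^ mv : ℕ) : ℝ) := by push_cast; exact le_rfl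
  have hhi : ((2 * L ^ mv : ℕ) : ℝ) + ((L ^ mv : ℕ) : ℝ) + (2 + 1) * ((L ^ mv : ℕ) : ℝ) + 1 ≤ ((6 * L ^ mv + 1 : ℕ) : ℝ) := by push_cast; linarith only []
  have hS6 : 6 * L ^ mv + 1 ≤ 2 * L * L ^ mv := by
    have h7 : 7 * L ^ mv ≤ L * L ^ mv := Nat.mul_le_mul_right _ hL7
    have e : 2 * L * L ^ mv = 2 * (L * L ^ mv) := by ring
    rw [e]; omega
  have hm₁ : 2 * L ^ mv ≤ coverMargin L mv := two_mul_le_coverMargin hL7 mv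
  have hfitI : coverMargin L mv - 2 * L ^ mv + (6 * L ^ mv + 1) ≤ L * L ^ mv := coverMargin_inner_fit hL7 hW2
  have hfit0 := coverMargin_fit hL3 mv
  have hfit : coverMargin L mv + 2 * L ^ mv + 1 ≤ L * L ^ mv := by omega
  have hS0 : L * L ^ mv ≤ 2 * L * L ^ mv := by rw [mul_assoc]; omega
  have hR2 : 1 + |(((L ^ r * L ^ kk : ℕ) : ℝ) * ((L ^ mv : ℕ) : ℝ))⁻¹| ≤ (2 : ℝ) := one_add_inv_le_of_two_le 2 hw le_rfl
  set η : ℝ := (((L ^ r * L ^ kk : ℕ) : ℝ))⁻¹ with hη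
  set W : ℝ := ((L ^ mv : ℕ) : ℝ) with hWdef
  have hηinv : η⁻¹ = ((L ^ r * L ^ kk : ℕ) : ℝ) := by rw [hη, inv_inv]
  set εT : ℝ := 2 ^ (d + 1) * (cN₀ * Real.exp (-((δm - 3 * δm / 4) * W)) * (C * Real.exp δ₀) * cr) with hεT
  -- the torus letters at spacing `(L^rL^k)^{-1}`
  have Hk := (H (mv + 1) kk r hk).2
  have hG := hasMaj_gOp_of_ineq (L := L) (k := kk) (cvM d L mv kk hL) (L ^ r * L ^ kk) a hn Hk hC.le
  have hD := fun ν => hasMaj_grad_of_ineq (L := L) (k := kk) (cvM d L mv kk hL) (L ^ r * L ^ kk) a hn Hk hC.le ν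
  have hNL := HL kk (L ^ r * L ^ kk) (cvM d L mv kk hL)
  -- the windows of the cut box about the partition cell (dag-n15-w4 V ∕ VII), radius 2
  have hwin2 : ∀ (μ : Fin (d + 1)) (k : Fin (d + 1) → ZMod (2 * L)) (p : CvX' d L mv kk r hL × ι),
      (∃ p₀ : CvX' d L mv kk r hL × ι, (p₀ = p ∨ p₀ = (fun μ => liftEquiv (bshiftEquiv (cvM d L mv kk hL) (L ^ r * L ^ kk) μ) ι) μ p ∨
          p₀ = ((fun μ => liftEquiv (bshiftEquiv (cvM d L mv kk hL) (L ^ r * L ^ kk) μ) ι) μ).symm p) ∧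
        ∀ ν, |cenRep (2 * L) ((fun ν (p : CvX' d L mv kk r hL × ι) => coverXi (cvM d L mv kk hL) (L ^ r * L ^ kk) (L ^ mv) ν p.1) ν p₀ - ((k ν).val : ℝ))| < 2 + 1) →
      (fun p : CvX' d L mv kk r hL × ι => cvChi' d L mv kk r hL k p.1) p = 1 :=
    fun μ k p hp => chiCube_cover_lift_eq_one_of_near_bbox 2 ι hM hw hlo hhi hS6 μ k p hp
  have hwin : ∀ (μ : Fin (d + 1)) (k : Fin (d + 1) → ZMod (2 * L)) (p : CvX' d L mv kk r hL × ι),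
      (∃ p₀ : CvX' d L mv kk r hL × ι, (p₀ = p ∨ p₀ = (fun μ => liftEquiv (bshiftEquiv (cvM d L mv kk hL) (L ^ r * L ^ kk) μ) ι) μ p ∨
          p₀ = ((fun μ => liftEquiv (bshiftEquiv (cvM d L mv kk hL) (L ^ r * L ^ kk) μ) ι) μ).symm p) ∧
        ∀ ν, |cenRep (2 * L) ((fun ν (p : CvX' d L mv kk r hL × ι) => coverXi (cvM d L mv kk hL) (L ^ r * L ^ kk) (L ^ mv) ν p.1) ν p₀ - ((k ν).val : ℝ))| < 1) →
      (fun p : CvX' d L mv kk r hL × ι => cvChi' d L mv kk r hL k p.1) p = 1 :=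
    fun μ k => hcubeWindow_of_bumpWindow (2 * L) (fun ν (p : CvX' d L mv kk r hL × ι) => coverXi (cvM d L mv kk hL) (L ^ r * L ^ kk) (L ^ mv) ν p.1) 2
      (fun μ => liftEquiv (bshiftEquiv (cvM d L mv kk hL) (L ^ r * L ^ kk) μ) ι) μ (by norm_num) (hwin2 μ k)
  -- the smallness (§3)
  have hq₀ : (β + (β₁ + π / W * β)) * (R * cr) * cr ≤ 1 / 2 := by
    have hπw : π / W ≤ π := div_le_self pi_pos.le hW1
    have h1 : (β + (β₁ + π / W * β)) * (R * cr) * cr ≤ (β + (β₁ + π * β)) * (R * cr) * cr := by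
      have := mul_le_mul_of_nonneg_right hπw hβ0
      exact mul_le_mul_of_nonneg_right (mul_le_mul_of_nonneg_right (by linarith only [this]) (by positivity)) hcr0
    have h2 : (β + (β₁ + π * β)) * (R * cr) * cr = ((β + (β₁ + π * β)) * cr * cr) / (2 * ((β + (β₁ + π * β)) * cr * cr) + 1) := by
      rw [hRdef]; ring
    have h3 : ((β + (β₁ + π * β)) * cr * cr) / (2 * ((β + (β₁ + π * β)) * cr * cr) + 1) ≤ 1 / 2 := by
      rw [div_le_iff₀ (by positivity)]
      have : 0 ≤ (β + (β₁ + π * β)) * cr * cr := by positivity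
      linarith only [this]
    linarith only [h1, h2, h3]
  have hθsm : Nov * cr * (cι2 * (θ₀ * (2 * (β + (β₁ + π * β))) * cr)) ≤ 1 / 4 := by
    have hX : 0 ≤ Nov * cr * (cι2 * (2 * (β + (β₁ + π * β))) * cr) := by positivity
    have e1 : Nov * cr * (cι2 * (θ₀ * (2 * (β + (β₁ + π * β))) * cr)) = θ₀ * (Nov * cr * (cι2 * (2 * (β + (β₁ + π * β))) * cr)) := by ring
    rw [e1, hθ₀def, div_mul_eq_mul_div, one_mul, div_le_iff₀ (by positivity)]
    linarith only [hX]
  have hεTle : εT ≤ κT / W := by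
    have hx : 0 < δm / 4 * W := by positivity
    have hexp : Real.exp (-((δm - 3 * δm / 4) * W)) ≤ (δm / 4 * W)⁻¹ := by
      rw [show (δm - 3 * δm / 4) * W = δm / 4 * W by ring, Real.exp_neg]
      exact inv_anti₀ hx (by linarith only [Real.add_one_le_exp (δm / 4 * W)])
    have h1 : εT ≤ 2 ^ (d + 1) * (cN₀ * (δm / 4 * W)⁻¹ * (C * Real.exp δ₀) * cr) := by
      rw [hεT]
      exact mul_le_mul_of_nonneg_left (mul_le_mul_of_nonneg_right (mul_le_mul_of_nonneg_right (mul_le_mul_of_nonneg_left hexp hcN₀0) (by positivity)) hcr0) (by positivity)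
    have h2 : 2 ^ (d + 1) * (cN₀ * (δm / 4 * W)⁻¹ * (C * Real.exp δ₀) * cr) = κT / W := by
      rw [hκTdef]; field_simp
    linarith only [h1, h2]
  have hsmall := cvSmall (Nov := Nov) (cr := cr) (cι2 := cι2) (cJ := (Fintype.card (Fin (d + 1)) : ℝ)) (β := β) (β₁ := β₁) (w := W) (R := R) (θF := θ₀) (ε₀ := εT)
    (ε := δm / 2) (E' := (Real.exp 1 * (δm / 2))⁻¹) (cN₀ := cN₀) (D := (d : ℝ) + 1) (κ := κT)
    hNov0 hcr0 (by positivity) (by positivity) hβ0 hβ₁0 hW1 hR0.le hθ₀0.le (by positivity) (by positivity) hcN₀0 (by positivity) hκT0 hq₀ hθsm hεTle hW0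
  -- 52's hypotheses at the cover
  have htri : Triangle254 (unitTorusGeo L kk (cvM d L mv kk hL)) := triangle254_unitTorusGeo L kk _
  have hd : ∀ a b : Tor (cvM d L mv kk hL), 0 ≤ (unitTorusGeo L kk (cvM d L mv kk hL)).dist a b := unitTorusGeo_dist_nonneg L kk _
  have hd0 : ∀ y : Tor (cvM d L mv kk hL), (unitTorusGeo L kk (cvM d L mv kk hL)).dist y y = 0 := unitTorusGeo_dist_self L kk _
  have hsymm : ∀ y y', (unitTorusGeo L kk (cvM d L mv kk hL)).dist y y' = (unitTorusGeo L kk (cvM d L mv kk hL)).dist y' y := unitTorusGeo_dist_symm L kk _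
  have hrow : RowSum (unitTorusGeo L kk (cvM d L mv kk hL)) (δm / 16) cr := by rw [hcr_def]; exact rowSum_unitTorusGeo L kk _ (by positivity)
  have hσ : 0 ≤ (δm / 16) := by positivity
  have hβ : 0 ≤ β := by positivity
  have hβ₁ : 0 ≤ β₁ := by positivity
  have hct : 0 ≤ (π / W) := div_nonneg pi_pos.le hWpos.le
  have hR : 0 ≤ R := by positivity
  have hε₀ : 0 ≤ εT := mul_nonneg (by positivity) (mul_nonneg (mul_nonneg (mul_nonneg hcN₀0 (Real.exp_nonneg _)) (mul_nonneg hC.le (Real.exp_nonneg _))) hcr0)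
  have hcr : 0 ≤ cr := hcr0
  have hNov : 0 ≤ Nov := by positivity
  have hσρ : (δm / 16) ≤ (δm / 2) := by linarith only [hδm0]
  have hρ₁V : (δm / 2) ≤ δm := by linarith only [hδm0]
  have hρ₁G : (δm / 2) + (δm / 16) ≤ δm := by linarith only [hδm0]
  have hρ₂ : 0 ≤ (δm / 4) := by positivity
  have hρ₂₁ : (δm / 4) + (δm / 16) ≤ (δm / 2) := by linarith only [hδm0]
  have hρ₂T : (δm / 4) + (δm / 16) ≤ (δm / 2) := by linarith only [hδm0]
  have hρ₃ : 0 ≤ (δm / 8) := by positivity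
  have hρ₃₂ : (δm / 8) ≤ (δm / 4) := by linarith only [hδm0]
  have hρ₃V : (δm / 8) + (δm / 16) ≤ δm - (δm / 2) := by linarith only [hδm0]
  have hρ₃N : (δm / 8) + (δm / 16) ≤ (δm - δm / 2) := by linarith only [hδm0]
  have hσρ₃ : 2 * (δm / 16) ≤ (δm / 8) := by linarith only [hδm0]
  have hε : 0 < (δm / 2) := by positivity
  have hc₁ : 0 ≤ (π / W) := div_nonneg pi_pos.le hWpos.le
  have hc₂ : 0 ≤ (32 * π ^ 2 / W ^ 2) := div_nonneg (by positivity) (pow_nonneg hWpos.le 2)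
  have hθW : 0 ≤ (0:ℝ) := le_rfl
  have hcN : 0 ≤ ((π * (d + 1) / W * (Real.exp 1 * (δm / 2))⁻¹ + 2 * (π * (d + 1) / W)) * cN₀) := mul_nonneg (add_nonneg (mul_nonneg (div_nonneg (by positivity) hWpos.le) (by positivity)) (mul_nonneg zero_le_two (div_nonneg (by positivity) hWpos.le))) hcN₀0
  have hℓ : 0 ≤ (π * (d + 1) / W) := div_nonneg (by positivity) hWpos.le
  have hω : 0 ≤ (π * (d + 1) / W) := div_nonneg (by positivity) hWpos.le
  have hd₁ : 0 ≤ (1:ℝ) := zero_le_one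
  have hSχ : ∀ k x, cvChi' d L mv kk r hL k x ≠ 0 → (fun b : CvX' d L mv kk r hL => blockOf (L ^ r * L ^ kk) (cvM d L mv kk hL) b.1) x ∈ cvSk d L mv kk hL k := fun k x hx => Finset.mem_coe.mpr (blockOf_mem_cubeBlocks_of_inner_ne_zero hM hm₁ hfitI hS0 hx)
  have hSψ : ∀ k x, cvPsi' d L mv kk r hL k x ≠ 0 → (fun b : CvX' d L mv kk r hL => blockOf (L ^ r * L ^ kk) (cvM d L mv kk hL) b.1) x ∈ cvSk d L mv kk hL k := fun k x hx => Finset.mem_coe.mpr (by by_contra h; exact hx (chiCube_of_not_mem h))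
  have hχt : ∀ k x, |cvBump' d L mv kk r hL k x| ≤ 1 := fun k x => abs_bcube_cover_le_one 2 k x
  have hdχt : ∀ k μ p, |fgrad η⁻¹ (liftEquiv (bshiftEquiv (cvM d L mv kk hL) (L ^ r * L ^ kk) μ) ι) (fun p : CvX' d L mv kk r hL × ι => cvBump' d L mv kk r hL k p.1) p| ≤ (π / W) := by rw [hηinv]; exact fun k μ p => abs_fgrad_bcube_cover_lift_le 2 ι hM hw k μ p
  have hdχtb : ∀ k μ p, |bgrad η⁻¹ (liftEquiv (bshiftEquiv (cvM d L mv kk hL) (L ^ r * L ^ kk) μ) ι) (fun p : CvX' d L mv kk r hL × ι => cvBump' d L mv kk r hL k p.1) p| ≤ (π / W) := by rw [hηinv]; exact fun k μ p => abs_bgrad_bcube_cover_lift_le 2 ι hM hw k μ p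
  have hsub : ∀ k, mulOp (fun p : CvX' d L mv kk r hL × ι => cvBump' d L mv kk r hL k p.1) ∘ₗ mulOp (fun p : CvX' d L mv kk r hL × ι => cvChi' d L mv kk r hL k p.1) = mulOp (fun p : CvX' d L mv kk r hL × ι => cvBump' d L mv kk r hL k p.1) := fun k => bcube_cover_lift_cut 2 ι hM hw hlo hhi hS6 k
  have hχ : ∀ k, mulOp (fun p : CvX' d L mv kk r hL × ι => cvChi' d L mv kk r hL k p.1) ∘ₗ mulOp (fun p : CvX' d L mv kk r hL × ι => cvBump' d L mv kk r hL k p.1) = mulOp (fun p : CvX' d L mv kk r hL × ι => cvBump' d L mv kk r hL k p.1) := fun k => cut_bcube_cover_lift 2 ι hM hw hlo hhi hS6 k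
  have hs : ∀ k μ, mulOp ((fun p : CvX' d L mv kk r hL × ι => cvBump' d L mv kk r hL k p.1) ∘ (liftEquiv (bshiftEquiv (cvM d L mv kk hL) (L ^ r * L ^ kk) μ) ι)) ∘ₗ mulOp (fun p : CvX' d L mv kk r hL × ι => cvChi' d L mv kk r hL k p.1) = mulOp ((fun p : CvX' d L mv kk r hL × ι => cvBump' d L mv kk r hL k p.1) ∘ (liftEquiv (bshiftEquiv (cvM d L mv kk hL) (L ^ r * L ^ kk) μ) ι)) := fun k μ => bcube_cover_lift_comp_shift_cut 2 ι hM hw hlo hhi hS6 k μ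
  have hsb : ∀ k μ, mulOp ((fun p : CvX' d L mv kk r hL × ι => cvBump' d L mv kk r hL k p.1) ∘ (liftEquiv (bshiftEquiv (cvM d L mv kk hL) (L ^ r * L ^ kk) μ) ι).symm) ∘ₗ mulOp (fun p : CvX' d L mv kk r hL × ι => cvChi' d L mv kk r hL k p.1) = mulOp ((fun p : CvX' d L mv kk r hL × ι => cvBump' d L mv kk r hL k p.1) ∘ (liftEquiv (bshiftEquiv (cvM d L mv kk hL) (L ^ r * L ^ kk) μ) ι).symm) := fun k μ => bcube_cover_lift_comp_shift_symm_cut 2 ι hM hw hlo hhi hS6 k μ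
  have hdd : ∀ k μ, mulOp (fgrad η⁻¹ (liftEquiv (bshiftEquiv (cvM d L mv kk hL) (L ^ r * L ^ kk) μ) ι) (fun p : CvX' d L mv kk r hL × ι => cvBump' d L mv kk r hL k p.1)) ∘ₗ mulOp (fun p : CvX' d L mv kk r hL × ι => cvChi' d L mv kk r hL k p.1) = mulOp (fgrad η⁻¹ (liftEquiv (bshiftEquiv (cvM d L mv kk hL) (L ^ r * L ^ kk) μ) ι) (fun p : CvX' d L mv kk r hL × ι => cvBump' d L mv kk r hL k p.1)) := fun k μ => fgrad_bcube_cover_lift_cut 2 ι hM hw hlo hhi hS6 η⁻¹ k μ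
  have hddb : ∀ k μ, mulOp (bgrad η⁻¹ (liftEquiv (bshiftEquiv (cvM d L mv kk hL) (L ^ r * L ^ kk) μ) ι) (fun p : CvX' d L mv kk r hL × ι => cvBump' d L mv kk r hL k p.1)) ∘ₗ mulOp (fun p : CvX' d L mv kk r hL × ι => cvChi' d L mv kk r hL k p.1) = mulOp (bgrad η⁻¹ (liftEquiv (bshiftEquiv (cvM d L mv kk hL) (L ^ r * L ^ kk) μ) ι) (fun p : CvX' d L mv kk r hL × ι => cvBump' d L mv kk r hL k p.1)) := fun k μ => bgrad_bcube_cover_lift_cut 2 ι hM hw hlo hhi hS6 η⁻¹ k μ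
  have hs' : ∀ k μ, mulOp (fun p : CvX' d L mv kk r hL × ι => cvChi' d L mv kk r hL k p.1) ∘ₗ mulOp ((fun p : CvX' d L mv kk r hL × ι => cvBump' d L mv kk r hL k p.1) ∘ (liftEquiv (bshiftEquiv (cvM d L mv kk hL) (L ^ r * L ^ kk) μ) ι)) = mulOp ((fun p : CvX' d L mv kk r hL × ι => cvBump' d L mv kk r hL k p.1) ∘ (liftEquiv (bshiftEquiv (cvM d L mv kk hL) (L ^ r * L ^ kk) μ) ι)) := fun k μ => cut_bcube_cover_lift_comp_shift 2 ι hM hw hlo hhi hS6 k μ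
  have hsb' : ∀ k μ, mulOp (fun p : CvX' d L mv kk r hL × ι => cvChi' d L mv kk r hL k p.1) ∘ₗ mulOp ((fun p : CvX' d L mv kk r hL × ι => cvBump' d L mv kk r hL k p.1) ∘ (liftEquiv (bshiftEquiv (cvM d L mv kk hL) (L ^ r * L ^ kk) μ) ι).symm) = mulOp ((fun p : CvX' d L mv kk r hL × ι => cvBump' d L mv kk r hL k p.1) ∘ (liftEquiv (bshiftEquiv (cvM d L mv kk hL) (L ^ r * L ^ kk) μ) ι).symm) := fun k μ => cut_bcube_cover_lift_comp_shift_symm 2 ι hM hw hlo hhi hS6 k μ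
  have hdd' : ∀ k μ, mulOp (fun p : CvX' d L mv kk r hL × ι => cvChi' d L mv kk r hL k p.1) ∘ₗ mulOp (fgrad η⁻¹ (liftEquiv (bshiftEquiv (cvM d L mv kk hL) (L ^ r * L ^ kk) μ) ι) (fun p : CvX' d L mv kk r hL × ι => cvBump' d L mv kk r hL k p.1)) = mulOp (fgrad η⁻¹ (liftEquiv (bshiftEquiv (cvM d L mv kk hL) (L ^ r * L ^ kk) μ) ι) (fun p : CvX' d L mv kk r hL × ι => cvBump' d L mv kk r hL k p.1)) := fun k μ => cut_fgrad_bcube_cover_lift 2 ι hM hw hlo hhi hS6 η⁻¹ k μ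
  have hddb' : ∀ k μ, mulOp (fun p : CvX' d L mv kk r hL × ι => cvChi' d L mv kk r hL k p.1) ∘ₗ mulOp (bgrad η⁻¹ (liftEquiv (bshiftEquiv (cvM d L mv kk hL) (L ^ r * L ^ kk) μ) ι) (fun p : CvX' d L mv kk r hL × ι => cvBump' d L mv kk r hL k p.1)) = mulOp (bgrad η⁻¹ (liftEquiv (bshiftEquiv (cvM d L mv kk hL) (L ^ r * L ^ kk) μ) ι) (fun p : CvX' d L mv kk r hL × ι => cvBump' d L mv kk r hL k p.1)) := fun k μ => cut_bgrad_bcube_cover_lift 2 ι hM hw hlo hhi hS6 η⁻¹ k μ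
  have hNψ : ∀ k, (cvCube' d L mv kk r hL a ι k) ∘ₗ mulOp (fun p : CvX' d L mv kk r hL × ι => cvPsi' d L mv kk r hL k p.1) = (cvCube' d L mv kk r hL a ι k) := fun k => cube_comp_psi_cover_lift (m₀ := coverMargin L mv) ι hM ha k
  have hcut : ∀ k, HasMaj (BlockNorm.ofBlocks (unitTorusGeo L kk (cvM d L mv kk hL)) (liftBlk (fun b : CvX' d L mv kk r hL => blockOf (L ^ r * L ^ kk) (cvM d L mv kk hL) b.1) ι)) (BlockNorm.ofBlocks (unitTorusGeo L kk (cvM d L mv kk hL)) (liftBlk (fun b : CvX' d L mv kk r hL => blockOf (L ^ r * L ^ kk) (cvM d L mv kk hL) b.1) ι)) (mulOp (fun p : CvX' d L mv kk r hL × ι => cvChi' d L mv kk r hL k p.1) ∘ₗ (cvCube' d L mv kk r hL a ι k)) (fun y y' => ind (g := unitTorusGeo L kk (cvM d L mv kk hL)) (cvSk d L mv kk hL k) y * ind (g := unitTorusGeo L kk (cvM d L mv kk hL)) (cvSk d L mv kk hL k) y' * (β * Real.exp (-(δm * (unitTorusGeo L kk (cvM d L mv kk hL)).dist y y')))) :=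 fun k => hasMaj_cut_cover_lift (m₀ := coverMargin L mv) ι hM hm₁ hfitI hS0 hC.le hδ₀.le hδmδ₀ hG k
  have hcutF : ∀ k μ, HasMaj (BlockNorm.ofBlocks (unitTorusGeo L kk (cvM d L mv kk hL)) (liftBlk (fun b : CvX' d L mv kk r hL => blockOf (L ^ r * L ^ kk) (cvM d L mv kk hL) b.1) ι)) (BlockNorm.ofBlocks (unitTorusGeo L kk (cvM d L mv kk hL)) (liftBlk (fun b : CvX' d L mv kk r hL => blockOf (L ^ r * L ^ kk) (cvM d L mv kk hL) b.1) ι)) (mulOp (fun p : CvX' d L mv kk r hL × ι => cvChi' d L mv kk r hL k p.1) ∘ₗ (fgrad η⁻¹ (liftEquiv (bshiftEquiv (cvM d L mv kk hL) (L ^ r * L ^ kk) μ) ι) ∘ₗ (cvCube' d L mv kk r hL a ι k))) (fun y y' => ind (g := unitTorusGeo L kk (cvM d L mv kk hL)) (cvSk d L mv kk hL k) y * ind (g := unitTorusGeo L kk (cvM d L mv kk hL)) (cvSk d L mv kk hL k) y' * (β₁ * Real.exp (-(δm * (unitTorusGeo L kk (cvM d L mv kk hL)).dist y y')))) := fun k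 μ => hasMaj_cutF_cover_lift (m₀ := coverMargin L mv) ι hM hm₁ hfitI hS0 hC hδ₀ hδmδ₀ hηinv μ (hD μ) k
  have hcutB : ∀ k μ, HasMaj (BlockNorm.ofBlocks (unitTorusGeo L kk (cvM d L mv kk hL)) (liftBlk (fun b : CvX' d L mv kk r hL => blockOf (L ^ r * L ^ kk) (cvM d L mv kk hL) b.1) ι)) (BlockNorm.ofBlocks (unitTorusGeo L kk (cvM d L mv kk hL)) (liftBlk (fun b : CvX' d L mv kk r hL => blockOf (L ^ r * L ^ kk) (cvM d L mv kk hL) b.1) ι)) (mulOp (fun p : CvX' d L mv kk r hL × ι => cvChi' d L mv kk r hL k p.1) ∘ₗ (bgrad η⁻¹ (liftEquiv (bshiftEquiv (cvM d L mv kk hL) (L ^ r * L ^ kk) μ) ι) ∘ₗ (cvCube' d L mv kk r hL a ι k))) (fun y y' => ind (g := unitTorusGeo L kk (cvM d L mv kk hL)) (cvSk d L mv kk hL k) y * ind (g := unitTorusGeo L kk (cvM d L mv kk hL)) (cvSk d L mv kk hL k) y' * (β₁ * Real.exp (-(δm * (unitTorusGeo L kk (cvM d L mv kk hL)).dist y y'))))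 := fun k μ => hasMaj_cutB_cover_lift (m₀ := coverMargin L mv) ι hM hm₁ hfitI hS0 hC hδ₀ hδmδ₀ hηinv μ (hD μ) k
  have hhabs : ∀ k x, |knitH d L mv kk (L ^ r * L ^ kk) hL k x| ≤ 1 := fun k x => abs_coverH_le_one k x
  have hhcut : ∀ k, mulOp (fun p : CvX' d L mv kk r hL × ι => knitH d L mv kk (L ^ r * L ^ kk) hL k p.1) ∘ₗ mulOp (fun p : CvX' d L mv kk r hL × ι => cvChi' d L mv kk r hL k p.1) = mulOp (fun p : CvX' d L mv kk r hL × ι => knitH d L mv kk (L ^ r * L ^ kk) hL k p.1) := fun k => hcube_cut (2 * L) (fun ν (p : CvX' d L mv kk r hL × ι) => coverXi (cvM d L mv kk hL) (L ^ r * L ^ kk) (L ^ mv) ν p.1) (fun μ => liftEquiv (bshiftEquiv (cvM d L mv kk hL) (L ^ r * L ^ kk) μ) ι) 0 (hwin 0 k)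
  have hh1 : ∀ k μ p, |fgrad η⁻¹ (liftEquiv (bshiftEquiv (cvM d L mv kk hL) (L ^ r * L ^ kk) μ) ι) (fun p : CvX' d L mv kk r hL × ι => knitH d L mv kk (L ^ r * L ^ kk) hL k p.1) p| ≤ (π / W) := by
    rw [hηinv]; intro k μ p
    have h := abs_fgrad_coverH_le hM hw k μ p.1
    rw [hWdef]
    simp only [knitH, fgrad_apply, liftEquiv_apply] at h ⊢
    exact h
  have hh1b : ∀ k μ p, |bgrad η⁻¹ (liftEquiv (bshiftEquiv (cvM d L mv kk hL) (L ^ r * L ^ kk) μ) ι) (fun p : CvX' d L mv kk r hL × ι => knitH d L mv kk (L ^ r * L ^ kk) hL k p.1) p| ≤ (π / W) := by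
    rw [hηinv]; intro k μ p
    have h := abs_bgrad_coverH_le hM hw k μ p.1
    rw [hWdef]
    simp only [knitH, bgrad_apply, liftEquiv_symm_apply] at h ⊢
    exact h
  have hh2 : ∀ k μ p, |fgradAdj η⁻¹ (liftEquiv (bshiftEquiv (cvM d L mv kk hL) (L ^ r * L ^ kk) μ) ι) (fgrad η⁻¹ (liftEquiv (bshiftEquiv (cvM d L mv kk hL) (L ^ r * L ^ kk) μ) ι) (fun p : CvX' d L mv kk r hL × ι => knitH d L mv kk (L ^ r * L ^ kk) hL k p.1)) p| ≤ (32 * π ^ 2 / W ^ 2) := by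
    rw [hηinv]; intro k μ p
    have h := abs_fgradAdj_fgrad_coverH_le hM hw k μ p.1
    rw [hWdef]
    simp only [knitH, fgradAdj_apply, fgrad_apply, liftEquiv_apply, liftEquiv_symm_apply] at h ⊢
    exact h
  have hLip : ∀ k y y', |coverHb (cvM d L mv kk hL) (L ^ r * L ^ kk) (L ^ mv) L k y - coverHb (cvM d L mv kk hL) (L ^ r * L ^ kk) (L ^ mv) L k y'| ≤ (π * (d + 1) / W) * (unitTorusGeo L kk (cvM d L mv kk hL)).dist y y' := fun k y y' => abs_coverHb_sub_le hM hw k y y'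
  have hrh : ∀ k (p : CvX' d L mv kk r hL × ι), |knitH d L mv kk (L ^ r * L ^ kk) hL k p.1 - coverHb (cvM d L mv kk hL) (L ^ r * L ^ kk) (L ^ mv) L k (liftBlk (fun b : CvX' d L mv kk r hL => blockOf (L ^ r * L ^ kk) (cvM d L mv kk hL) b.1) ι p)| ≤ (π * (d + 1) / W) := fun k p => abs_coverH_sub_coverHb_le hM hw k p.1
  have hstep : ∀ μ x, (unitTorusGeo L kk (cvM d L mv kk hL)).dist ((fun b : CvX' d L mv kk r hL => blockOf (L ^ r * L ^ kk) (cvM d L mv kk hL) b.1) (bshiftEquiv (cvM d L mv kk hL) (L ^ r * L ^ kk) μ x)) ((fun b : CvX' d L mv kk r hL => blockOf (L ^ r * L ^ kk) (cvM d L mv kk hL) b.1) x) ≤ (1:ℝ) :=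
    fun μ x => by
    have h := tdistT_blockOf_sub_unitVec_le (L ^ r * L ^ kk) (cvM d L mv kk hL) (x.1 + unitVec (fine (L ^ r * L ^ kk) (cvM d L mv kk hL)) μ) μ
    rw [add_sub_cancel_right, tdistT_symm] at h
    exact h
  have hN : ∀ a, ∑ k, ind (g := unitTorusGeo L kk (cvM d L mv kk hL)) (cvSk d L mv kk hL k) a ≤ Nov := fun y => sum_ind_cubeBlocks_le (M := cvM d L mv kk hL) (w := L ^ mv) (q := L) (m₀ := coverMargin L mv) L kk y
  have hT : ∀ k, HasMaj (BlockNorm.ofBlocks (unitTorusGeo L kk (cvM d L mv kk hL)) (liftBlk (fun b : CvX' d L mv kk r hL => blockOf (L ^ r * L ^ kk) (cvM d L mv kk hL) b.1) ι)) (BlockNorm.ofBlocks (unitTorusGeo L kk (cvM d L mv kk hL)) (liftBlk (fun b : CvX' d L mv kk r hL => blockOf (L ^ r * L ^ kk) (cvM d L mv kk hL) b.1) ι)) ((-(mulOp (fun p : CvX' d L mv kk r hL × ι => knitH d L mv kk (L ^ r * L ^ kk) hL k p.1) ∘ₗ (cvNL' d L mv kk r hL a ι) ∘ₗ mulOp (1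 - fun p : CvX' d L mv kk r hL × ι => cvBump' d L mv kk r hL k p.1))) ∘ₗ (cvCube' d L mv kk r hL a ι k)) (fun y y' => ind (g := unitTorusGeo L kk (cvM d L mv kk hL)) (cvSk d L mv kk hL k) y * ind (g := unitTorusGeo L kk (cvM d L mv kk hL)) (cvSk d L mv kk hL k) y' * (εT * Real.exp (-((δm / 2) * (unitTorusGeo L kk (cvM d L mv kk hL)).dist y y')))) := fun k => hasMaj_tail_cover_lift (m₀ := coverMargin L mv) (δN := δm) (ρ₁ := 3 * δm / 4) (ρ := δm / 2) ι hM hM' hw hL2 hfit hS0 htri hrow hC.le hδ₀.le hC₁.le hδm0.le hδmδ₁ (by linarith only [hδm0]) (by positivity) (by linarith only [hδmδ₀, hδm0]) (by linarith only [hδm0]) hG hNL k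
  have hq : (β + (β₁ + (π / W) * β)) * (R * cr) * cr < 1 := hq₀.trans_lt (by norm_num)
  have hKN : ∀ k, HasMaj (BlockNorm.ofBlocks (unitTorusGeo L kk (cvM d L mv kk hL)) (liftBlk (fun b : CvX' d L mv kk r hL => blockOf (L ^ r * L ^ kk) (cvM d L mv kk hL) b.1) ι)) (BlockNorm.ofBlocks (unitTorusGeo L kk (cvM d L mv kk hL)) (liftBlk (fun b : CvX' d L mv kk r hL => blockOf (L ^ r * L ^ kk) (cvM d L mv kk hL) b.1) ι)) (commOp (cvNL' d L mv kk r hL a ι) (fun p : CvX' d L mv kk r hL × ι => knitH d L mv kk (L ^ r * L ^ kk) hL k p.1)) (fun y y' => ((π * (d + 1) / W * (Real.exp 1 * (δm / 2))⁻¹ + 2 * (π * (d + 1) / W)) * cN₀) * Real.exp (-((δm - δm / 2) * (unitTorusGeo L kk (cvM d L mv kk hL)).dist y y'))) := fun k => hasMaj_commOp_nonlocal_cover_lift (δN := δm) ι hM hw hC₁.le hδm0.le hδmδ₁ (half_pos hδm0) hNL k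
  have hθF : 0 ≤ θ₀ := hθ₀0.le
  have hρF : (δm / 8) + (δm / 16) ≤ δm := by linarith only [hδm0]
  have hχ1 : ∀ k x, |cvChi' d L mv kk r hL k x| ≤ 1 := fun k x => abs_chiCube_le_one _ x
  have hψχ : ∀ k, mulOp (fun p : CvX' d L mv kk r hL × ι => cvPsi' d L mv kk r hL k p.1) ∘ₗ mulOp (fun p : CvX' d L mv kk r hL × ι => cvChi' d L mv kk r hL k p.1) = mulOp (fun p : CvX' d L mv kk r hL × ι => cvChi' d L mv kk r hL k p.1) := fun k => mulOp_comp_mulOp_of_support_left fun p hp => chiCube_eq_one_of_inner_ne_zero hM hm₁ hfitI hS0 hp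
  have hfarN : ∀ k, HasMaj (BlockNorm.ofBlocks (unitTorusGeo L kk (cvM d L mv kk hL)) (liftBlk (fun b : CvX' d L mv kk r hL => blockOf (L ^ r * L ^ kk) (cvM d L mv kk hL) b.1) ι)) (BlockNorm.ofBlocks (unitTorusGeo L kk (cvM d L mv kk hL)) (liftBlk (fun b : CvX' d L mv kk r hL => blockOf (L ^ r * L ^ kk) (cvM d L mv kk hL) b.1) ι)) ((LinearMap.id - mulOp (fun p : CvX' d L mv kk r hL × ι => cvPsi' d L mv kk r hL k p.1)) ∘ₗ NV k ∘ₗ mulOp (fun p : CvX' d L mv kk r hL × ι => cvChi' d L mv kk r hL k p.1)) (fun y y' => θ₀ * Real.exp (-(δm * (unitTorusGeo L kk (cvM d L mv kk hL)).dist y y'))) := fun k => (hfarN k).mono fun y y' => mul_le_mul_of_nonneg_right hθle (Real.exp_nonneg _)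
  have hhψ : ∀ k, mulOp (fun p : CvX' d L mv kk r hL × ι => knitH d L mv kk (L ^ r * L ^ kk) hL k p.1) ∘ₗ mulOp (fun p : CvX' d L mv kk r hL × ι => cvPsi' d L mv kk r hL k p.1) = mulOp (fun p : CvX' d L mv kk r hL × ι => knitH d L mv kk (L ^ r * L ^ kk) hL k p.1) := fun k => mulOp_comp_mulOp_of_support fun p hp => chiCube_coverCorner_eq_one hM hw hfit 0 k p.1 ⟨p.1, Or.inl rfl, abs_cenRep_lt_one_of_hcube_ne_zero (2 * L) (coverXi (cvM d L mv kk hL) (L ^ r * L ^ kk) (L ^ mv)) hp⟩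
  have hχh : ∀ k, mulOp (fun p : CvX' d L mv kk r hL × ι => cvChi' d L mv kk r hL k p.1) ∘ₗ mulOp (fun p : CvX' d L mv kk r hL × ι => knitH d L mv kk (L ^ r * L ^ kk) hL k p.1) = mulOp (fun p : CvX' d L mv kk r hL × ι => knitH d L mv kk (L ^ r * L ^ kk) hL k p.1) := fun k => cut_hcube (2 * L) (fun ν (p : CvX' d L mv kk r hL × ι) => coverXi (cvM d L mv kk hL) (L ^ r * L ^ kk) (L ^ mv) ν p.1) 2 (fun μ => liftEquiv (bshiftEquiv (cvM d L mv kk hL) (L ^ r * L ^ kk) μ) ι) 0 (by norm_num) (hwin2 0 k)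
  have hhs' : ∀ k μ, mulOp (fun p : CvX' d L mv kk r hL × ι => cvChi' d L mv kk r hL k p.1) ∘ₗ mulOp ((fun p : CvX' d L mv kk r hL × ι => knitH d L mv kk (L ^ r * L ^ kk) hL k p.1) ∘ (liftEquiv (bshiftEquiv (cvM d L mv kk hL) (L ^ r * L ^ kk) μ) ι)) = mulOp ((fun p : CvX' d L mv kk r hL × ι => knitH d L mv kk (L ^ r * L ^ kk) hL k p.1) ∘ (liftEquiv (bshiftEquiv (cvM d L mv kk hL) (L ^ r * L ^ kk) μ) ι)) := fun k μ => cut_hcube_comp_shift (2 * L) (fun ν (p : CvX' d L mv kk r hL × ι) => coverXi (cvM d L mv kk hL) (L ^ r * L ^ kk) (L ^ mv) ν p.1) 2 (fun μ => liftEquiv (bshiftEquiv (cvM d L mv kk hL) (L ^ r * L ^ kk) μ) ι) μ (by norm_num) (hwin2 μ k)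
  have hhsb' : ∀ k μ, mulOp (fun p : CvX' d L mv kk r hL × ι => cvChi' d L mv kk r hL k p.1) ∘ₗ mulOp ((fun p : CvX' d L mv kk r hL × ι => knitH d L mv kk (L ^ r * L ^ kk) hL k p.1) ∘ (liftEquiv (bshiftEquiv (cvM d L mv kk hL) (L ^ r * L ^ kk) μ) ι).symm) = mulOp ((fun p : CvX' d L mv kk r hL × ι => knitH d L mv kk (L ^ r * L ^ kk) hL k p.1) ∘ (liftEquiv (bshiftEquiv (cvM d L mv kk hL) (L ^ r * L ^ kk) μ) ι).symm) := fun k μ => cut_hcube_comp_shift_symm (2 * L) (fun ν (p : CvX' d L mv kk r hL × ι) => coverXi (cvM d L mv kk hL) (L ^ r * L ^ kk) (L ^ mv) ν p.1) 2 (fun μ => liftEquiv (bshiftEquiv (cvM d L mv kk hL) (L ^ r * L ^ kk) μ) ι) μ (by norm_num) (hwin2 μ k)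
  have hhdd' : ∀ k μ, mulOp (fun p : CvX' d L mv kk r hL × ι => cvChi' d L mv kk r hL k p.1) ∘ₗ mulOp (fgrad η⁻¹ (liftEquiv (bshiftEquiv (cvM d L mv kk hL) (L ^ r * L ^ kk) μ) ι) (fun p : CvX' d L mv kk r hL × ι => knitH d L mv kk (L ^ r * L ^ kk) hL k p.1)) = mulOp (fgrad η⁻¹ (liftEquiv (bshiftEquiv (cvM d L mv kk hL) (L ^ r * L ^ kk) μ) ι) (fun p : CvX' d L mv kk r hL × ι => knitH d L mv kk (L ^ r * L ^ kk) hL k p.1)) := fun k μ => cut_fgrad_hcube (2 * L) (fun ν (p : CvX' d L mv kk r hL × ι) => coverXi (cvM d L mv kk hL) (L ^ r * L ^ kk) (L ^ mv) ν p.1) 2 (fun μ => liftEquiv (bshiftEquiv (cvM d L mv kk hL) (L ^ r * L ^ kk) μ) ι) μ (by norm_num) η⁻¹ (hwin2 μ k)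
  have hhddb' : ∀ k μ, mulOp (fun p : CvX' d L mv kk r hL × ι => cvChi' d L mv kk r hL k p.1) ∘ₗ mulOp (bgrad η⁻¹ (liftEquiv (bshiftEquiv (cvM d L mv kk hL) (L ^ r * L ^ kk) μ) ι) (fun p : CvX' d L mv kk r hL × ι => knitH d L mv kk (L ^ r * L ^ kk) hL k p.1)) = mulOp (bgrad η⁻¹ (liftEquiv (bshiftEquiv (cvM d L mv kk hL) (L ^ r * L ^ kk) μ) ι) (fun p : CvX' d L mv kk r hL × ι => knitH d L mv kk (L ^ r * L ^ kk) hL k p.1)) := fun k μ => cut_bgrad_hcube (2 * L) (fun ν (p : CvX' d L mv kk r hL × ι) => coverXi (cvM d L mv kk hL) (L ^ r * L ^ kk) (L ^ mv) ν p.1) 2 (fun μ => liftEquiv (bshiftEquiv (cvM d L mv kk hL) (L ^ r * L ^ kk) μ) ι) μ (by norm_num) η⁻¹ (hwin2 μ k)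
  have hq' : Nov * ((Fintype.card ι : ℝ) ^ 2 * ((((Fintype.card (Fin (d + 1)) : ℝ) * ((32 * π ^ 2 / W ^ 2) * ((β + (β₁ + (π / W) * β)) * (1 - (β + (β₁ + (π / W) * β)) * (R * cr) * cr)⁻¹) + 2 * ((π / W) * ((β + (β₁ + (π / W) * β)) * (1 - (β + (β₁ + (π / W) * β)) * (R * cr) * cr)⁻¹))) + (0:ℝ) + ((π * (d + 1) / W * (Real.exp 1 * (δm / 2))⁻¹ + 2 * (π * (d + 1) / W)) * cN₀) * ((β + (β₁ + (π / W) * β)) * (1 - (β + (β₁ + (π / W) * β)) * (R * cr) * cr)⁻¹) * cr)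
          + (((π * (d + 1) / W) * (Real.exp 1 * (δm / 2))⁻¹ + 2 * ((π * (d + 1) / W) + (π * (d + 1) / W) * (1:ℝ))) * R * ((β + (β₁ + (π / W) * β)) * (1 - (β + (β₁ + (π / W) * β)) * (R * cr) * cr)⁻¹) * cr + R * (π / W) * ((β + (β₁ + (π / W) * β)) * (1 - (β + (β₁ + (π / W) * β)) * (R * cr) * cr)⁻¹) * cr)) + (θ₀ * (1 * ((β + (β₁ + (π / W) * β)) * (1 - (β + (β₁ + (π / W) * β)) * (R * cr) * cr)⁻¹)) * cr)) + (Fintype.card ι : ℝ) ^ 2 * ((εT * (1 - (β + (β₁ + (π / W) * β)) * (R * cr) * cr)⁻¹) + 0)) * cr < 1 := hsmall.1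
  have h236 : ∀ x, ∑ k, knitH d L mv kk (L ^ r * L ^ kk) hL k x ^ 2 = 1 := fun x => sum_coverH_sq x
  have hloc0 : ∀ k, mulOp (fun p : CvX' d L mv kk r hL × ι => knitH d L mv kk (L ^ r * L ^ kk) hL k p.1) ∘ₗ (lapOp η⁻¹ (fun μ => liftEquiv (bshiftEquiv (cvM d L mv kk hL) (L ^ r * L ^ kk) μ) ι) 0 + (cvNL' d L mv kk r hL a ι)) ∘ₗ (cvCube' d L mv kk r hL a ι k) = mulOp (fun p : CvX' d L mv kk r hL × ι => knitH d L mv kk (L ^ r * L ^ kk) hL k p.1) := fun k => loc0_cover_lift (m₀ := coverMargin L mv) ι hM hw hfit ha hηinv k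
  have hLrow : ∀ k, mulOp (fun p : CvX' d L mv kk r hL × ι => knitH d L mv kk (L ^ r * L ^ kk) hL k p.1) ∘ₗ lapOp η⁻¹ (fun μ => liftEquiv (bshiftEquiv (cvM d L mv kk hL) (L ^ r * L ^ kk) μ) ι) 0 ∘ₗ mulOp (1 - fun p : CvX' d L mv kk r hL × ι => cvBump' d L mv kk r hL k p.1) = 0 := fun k => mulOp_coverH_lift_comp_lapOp_comp_one_sub_bcube_cover_lift 2 ι hM hw hR2 η⁻¹ 0 k (by rw [LinearMap.zero_comp, LinearMap.comp_zero])
  refine ⟨?_, ?_⟩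
  · -- 52's decay capstone
    have key := uN_hasMaj_glueInv_smoothCutDressed_localGauges (X := CvX' d L mv kk r hL) (ι := ι) (J := Fin (d + 1)) (K := Fin (d + 1) → ZMod (2 * L))
      (g := unitTorusGeo L kk (cvM d L mv kk hL)) (fun b : CvX' d L mv kk r hL => blockOf (L ^ r * L ^ kk) (cvM d L mv kk hL) b.1) (bshiftEquiv (cvM d L mv kk hL) (L ^ r * L ^ kk))
      (N := cvCube' d L mv kk r hL a ι) (NL := cvNL' d L mv kk r hL a ι) (χX := cvChi' d L mv kk r hL) (χtX := cvBump' d L mv kk r hL) (ψX := cvPsi' d L mv kk r hL)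
      (hX := knitH d L mv kk (L ^ r * L ^ kk) hL) (Sk := cvSk d L mv kk hL) (hb := coverHb (cvM d L mv kk hL) (L ^ r * L ^ kk) (L ^ mv) L)
      (htri := htri) (hd := hd) (hd0 := hd0) (hsymm := hsymm) (hrow := hrow) (hσ := hσ) (hβ := hβ) (hβ₁ := hβ₁) (hct := hct) (hR := hR) (hε₀ := hε₀) (hcr := hcr) (hNov := hNov) (hσρ := hσρ) (hρ₁V := hρ₁V) (hρ₁G := hρ₁G) (hρ₂ := hρ₂) (hρ₂₁ := hρ₂₁) (hρ₂T := hρ₂T) (hρ₃ := hρ₃) (hρ₃₂ := hρ₃₂) (hρ₃V := hρ₃V) (hρ₃N := hρ₃N) (hσρ₃ := hσρ₃) (hε := hε) (hc₁ := hc₁) (hc₂ := hc₂) (hθW := hθW) (hcN := hcN) (hℓ := hℓ) (hω := hω) (hd₁ := hd₁) (hSχ := hSχ) (hSψ := hSψ) (hχt := hχt) (hdχt := hdχt) (hdχtb := hdχtb) (hsub := hsub) (hχ := hχ) (hs := hs) (hsb := hsb) (hdd := hdd) (hddb := hddb) (hs' := hs') (hsb' := hsb') (hdd' := hdd') (hddb'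 := hddb') (hNψ := hNψ) (hcut := hcut) (hcutF := hcutF) (hcutB := hcutB) (hhabs := hhabs) (hhcut := hhcut) (hh1 := hh1) (hh1b := hh1b) (hh2 := hh2) (hLip := hLip) (hrh := hrh) (hstep := hstep) (hN := hN) (hT := hT) (hq := hq) (hKN := hKN) (he := he) (hu := hu) (hrV := hrV) (hRN := hRN) (hθF := hθF) (hρF := hρF) (hRle := hRle) (hP := hP) (hχ1 := hχ1) (hψχ := hψχ) (hCloc := hCloc) (hAloc := hAloc) (hNVcut := hNVcut) (hfarN := hfarN) (hhψ := hhψ) (hχh := hχh) (hhs' := hhs') (hhsb' := hhsb') (hhdd' := hhdd') (hhddb' := hhddb') (hq' := hq')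
    refine key.mono fun y y' => le_of_le_of_eq (mul_le_mul_of_nonneg_right (hsmall.2.trans (le_add_of_nonneg_right zero_le_one)) (Real.exp_nonneg _)) ?_
    rw [show δm / 8 - δm / 16 = δm / 16 by ring]
  · -- 52's two-sided inverse capstone
    exact uN_glueInv_smoothCutDressed_localGauges_inverse (X := CvX' d L mv kk r hL) (ι := ι) (J := Fin (d + 1)) (K := Fin (d + 1) → ZMod (2 * L))
      (g := unitTorusGeo L kk (cvM d L mv kk hL)) (fun b : CvX' d L mv kk r hL => blockOf (L ^ r * L ^ kk) (cvM d L mv kk hL) b.1) (bshiftEquiv (cvM d L mv kk hL) (L ^ r * L ^ kk))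
      (N := cvCube' d L mv kk r hL a ι) (NL := cvNL' d L mv kk r hL a ι) (χX := cvChi' d L mv kk r hL) (χtX := cvBump' d L mv kk r hL) (ψX := cvPsi' d L mv kk r hL)
      (hX := knitH d L mv kk (L ^ r * L ^ kk) hL) (Sk := cvSk d L mv kk hL) (hb := coverHb (cvM d L mv kk hL) (L ^ r * L ^ kk) (L ^ mv) L)
      (htri := htri) (hd := hd) (hd0 := hd0) (hsymm := hsymm) (hrow := hrow) (hσ := hσ) (hβ := hβ) (hβ₁ := hβ₁) (hct := hct) (hR := hR) (hε₀ := hε₀) (hcr := hcr) (hNov := hNov) (hσρ := hσρ) (hρ₁V := hρ₁V) (hρ₁G := hρ₁G) (hρ₂ := hρ₂) (hρ₂₁ := hρ₂₁) (hρ₂T := hρ₂T) (hρ₃ := hρ₃) (hρ₃₂ := hρ₃₂) (hρ₃V := hρ₃V) (hρ₃N := hρ₃N) (hσρ₃ := hσρ₃) (hε := hε) (hc₁ := hc₁) (hc₂ := hc₂) (hθW := hθW) (hcN := hcN) (hℓ := hℓ) (hω := hω) (hd₁ := hd₁) (hSχ := hSχ) (hSψ := hSψ) (hχt := hχt) (hdχt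 := hdχt) (hdχtb := hdχtb) (hsub := hsub) (hχ := hχ) (hs := hs) (hsb := hsb) (hdd := hdd) (hddb := hddb) (hs' := hs') (hsb' := hsb') (hdd' := hdd') (hddb' := hddb') (hNψ := hNψ) (hcut := hcut) (hcutF := hcutF) (hcutB := hcutB) (hhabs := hhabs) (h236 := h236) (hh1 := hh1) (hh1b := hh1b) (hh2 := hh2) (hLip := hLip) (hrh := hrh) (hstep := hstep) (hN := hN) (hloc0 := hloc0) (hL := hLrow) (hT := hT) (hq := hq) (hKN := hKN) (he := he) (hu := hu) (hrV := hrV) (hRN := hRN) (hθF := hθF) (hρF := hρF) (hRle := hRle) (hP := hP) (hχ1 := hχ1) (hψχ := hψχ) (hCloc := hCloc) (hAloc := hAloc) (hNVcut := hNVcut) (hfarN := hfarN) (hhψ := hhψ) (hχh := hχh) (hhs' := hhs') (hhsb' := hhsb') (hhdd' := hhdd') (hhddb' := hhddb') (hq' := hq')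

end Knit

end Summit.QuantumFields.YangMills.BalabanUVNodes.N15.Gluing

end
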